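import Mathlib
import HarnessLib
import Summits.HubbardSuperconductivity.HubbardSuperconductivity.Theorems.KLProgrammeKLRegimeWickClusterSplit

/-!
# Route `KLProgramme` — ENGINE child (E2-v9): BLOCK GLUING — a Gaussian convolution of a product of block-supported even factors splits into
# the intra-block convolutions and the INTER-BLOCK lines (generic; E2-WICK-ROADMAP §5 (i) second half, the combinatorial core; seat p1 g8)

For a cluster map `cl : Γ → ι`, a finite family `π` of pairwise DISJOINT blocks `B : Finset ι`, and even factors `x B` supported on the clusters of `B`:

  `e^{Δ_E} (∏_{B∈π} x B) = e^{Δ_{interCov cl π E}} (∏_{B∈π} e^{Δ_{inCov cl B E}} (x B))`        (`gaussConv_prod_blocks`)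

where `interCov cl π E` keeps exactly the pairs of `E` whose clusters are NOT in a common block of `π` (so no intra-block pair, in particular no
self-pair).  Iterating `gaussConv_mul_clusterSplit` (p490101) block by block; the matrix bookkeeping is `interCov_insert` and
`inCov_outCov_of_disjoint`.  This is the gluing step of the Wick cumulant partition formula
`e^{Δ_D}𝓔ᵀ_C(W) = Σ_{π ∈ setPartitions W} (−1)^{|π|−1}(|π|−1)! · e^{Δ_{interCov D π}}(∏_{B∈π} ν(B))` (`…WickCumulantPartition`, next file).
Products are taken in the commutative `evenPart`.  Proved; definitions `sameBlock`, `interCov` only.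
-/

noncomputable section

namespace Summit.HubbardSuperconductivity.HubbardSuperconductivity.Theorems.KLRegimeWick

set_option linter.dupNamespace false -- summit = problem name (single-conjunct summit), D-0017

open Literature.MathematicalPhysics.QuantumLattice GrassmannAlgebra Finset Matrix

section Blocks

variable (R : Type*) [CommRing R] {Γ : Type*} [Fintype Γ] [DecidableEq Γ] {ι : Type*} [DecidableEq ι] (cl : Γ → ι)

/-- Two clusters lie in a common block of the family `π`. -/
def sameBlock (π : Finset (Finset ι)) (a b : ι) : Prop := ∃ B ∈ π, a ∈ B ∧ b ∈ B

/-- `sameBlock` is decidable (finite blocks, decidable equality on clusters). -/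
instance instDecidableSameBlock (π : Finset (Finset ι)) (a b : ι) : Decidable (sameBlock π a b) := by
  unfold sameBlock; infer_instance

/-- The INTER-block part of a covariance: pairs whose clusters are not in a common block of `π`. -/
def interCov (π : Finset (Finset ι)) (E : Matrix Γ Γ R) : Matrix Γ Γ R :=
  Matrix.of fun X Y => if sameBlock π (cl X) (cl Y) then 0 else E X Y

omit [Fintype Γ] [DecidableEq Γ] in
/-- No blocks: every pair is inter-block. -/
theorem interCov_empty (E : Matrix Γ Γ R) : interCov R cl (∅ : Finset (Finset ι)) E = E := by
  ext X Y
  simp [interCov, sameBlock]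

omit [Fintype Γ] [DecidableEq Γ] in
/-- **Inserting a block**: `interCov (insert B₀ π) E = crossCovOf B₀ E + interCov π (outCov B₀ E)` when `B₀` is disjoint from every block of `π`. -/
theorem interCov_insert (π : Finset (Finset ι)) (B₀ : Finset ι) (hdisj : ∀ B ∈ π, Disjoint B₀ B) (E : Matrix Γ Γ R) :
    interCov R cl (insert B₀ π) E = crossCovOf R cl (↑B₀ : Set ι) E + interCov R cl π (outCov R cl (↑B₀ : Set ι) E) := by
  ext X Y
  simp only [interCov, crossCovOf, outCov, Matrix.add_apply, Matrix.of_apply, Finset.mem_coe]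
  have hsame : sameBlock (insert B₀ π) (cl X) (cl Y) ↔ (cl X ∈ B₀ ∧ cl Y ∈ B₀) ∨ sameBlock π (cl X) (cl Y) := by
    simp only [sameBlock, Finset.mem_insert, or_and_right, exists_or, exists_eq_left]
  -- blocks of `π` avoid `B₀`
  have hout : sameBlock π (cl X) (cl Y) → cl X ∉ B₀ ∧ cl Y ∉ B₀ := by
    rintro ⟨B, hB, hXB, hYB⟩
    exact ⟨fun h => Finset.disjoint_left.1 (hdisj B hB) h hXB, fun h => Finset.disjoint_left.1 (hdisj B hB) h hYB⟩
  by_cases hX : cl X ∈ B₀ <;> by_cases hY : cl Y ∈ B₀ <;> by_cases hs : sameBlock π (cl X) (cl Y) <;>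
    simp_all

omit [Fintype Γ] [DecidableEq Γ] in
/-- Inside a block disjoint from `B₀`, removing the `B₀` pairs changes nothing: `inCov B (outCov B₀ E) = inCov B E`. -/
theorem inCov_outCov_of_disjoint {B₀ B : Finset ι} (h : Disjoint B₀ B) (E : Matrix Γ Γ R) :
    inCov R cl (↑B : Set ι) (outCov R cl (↑B₀ : Set ι) E) = inCov R cl (↑B : Set ι) E := by
  ext X Y
  simp only [inCov, outCov, Matrix.of_apply, Finset.mem_coe]
  by_cases hX : cl X ∈ B
  · by_cases hY : cl Y ∈ B
    · simp [hX, hY, Finset.disjoint_right.1 h hX, Finset.disjoint_right.1 h hY]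
    · simp [hY]
  · simp [hX]

variable [Algebra ℚ R]

/-- **Block gluing**: for a family `π` of pairwise disjoint blocks and even factors `x B` supported on the clusters of `B`,
`e^{Δ_E} (∏_{B∈π} x B) = e^{Δ_{interCov π E}} (∏_{B∈π} e^{Δ_{inCov B E}} (x B))`. -/
theorem gaussConv_prod_blocks (x : Finset ι → evenPart R Γ)
    (hx : ∀ B : Finset ι, (x B : GrassmannAlgebra R Γ) ∈ fieldSubalgebra R (cl ⁻¹' (↑B : Set ι))) :
    ∀ (π : Finset (Finset ι)), (∀ B ∈ π, ∀ B' ∈ π, B ≠ B' → Disjoint B B') → ∀ (E : Matrix Γ Γ R),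
      gaussConv R E ((∏ B ∈ π, x B : evenPart R Γ) : GrassmannAlgebra R Γ) =
        gaussConv R (interCov R cl π E) ((∏ B ∈ π, (⟨gaussConv R (inCov R cl (↑B : Set ι) E) (x B), (mem_evenPart_iff).2
          (gaussConv_mem_evenOdd R _ ((mem_evenPart_iff).1 (x B).2))⟩ : evenPart R Γ) : evenPart R Γ) : GrassmannAlgebra R Γ) := by
  intro π
  induction π using Finset.induction_on with
  | empty =>
    intro _ E
    simp
  | insert B₀ π hB₀ ih =>
    intro hdisj E
    have hdisj' : ∀ B ∈ π, ∀ B' ∈ π, B ≠ B' → Disjoint B B' := fun B hB B' hB' hne =>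
      hdisj B (Finset.mem_insert_of_mem hB) B' (Finset.mem_insert_of_mem hB') hne
    have hdisj0 : ∀ B ∈ π, Disjoint B₀ B := fun B hB =>
      hdisj B₀ (Finset.mem_insert_self _ _) B (Finset.mem_insert_of_mem hB) (fun h => hB₀ (h ▸ hB))
    -- supports: the remaining product lives outside `B₀`
    have hrest : ∀ (z : Finset ι → evenPart R Γ), (∀ B : Finset ι, (z B : GrassmannAlgebra R Γ) ∈ fieldSubalgebra R (cl ⁻¹' (↑B : Set ι))) →
        ((∏ B ∈ π, z B : evenPart R Γ) : GrassmannAlgebra R Γ) ∈ fieldSubalgebra R (cl ⁻¹' (↑B₀ : Set ι)ᶜ) := by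
      intro z hz
      refine coe_prod_mem _ _ π fun B hB => fieldSubalgebra_mono R (Set.preimage_mono ?_) (hz B)
      intro i hi hi0
      exact Finset.disjoint_left.1 (hdisj0 B hB) hi0 hi
    rw [Finset.prod_insert hB₀, Finset.prod_insert hB₀, Subalgebra.coe_mul, Subalgebra.coe_mul,
      gaussConv_mul_clusterSplit R cl (↑B₀ : Set ι) E (hx B₀) ((mem_evenPart_iff).1 (x B₀).2) (hrest x hx),
      ih hdisj' (outCov R cl (↑B₀ : Set ι) E), interCov_insert R cl π B₀ hdisj0 E, gaussConv_add_apply]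
    -- the inter-block operator of the rest passes the `B₀` factor (it charges no label of `B₀`)
    have hpass : ∀ (u v : GrassmannAlgebra R Γ), u ∈ fieldSubalgebra R (cl ⁻¹' (↑B₀ : Set ι)) → u ∈ evenOdd R 0 →
        gaussConv R (interCov R cl π (outCov R cl (↑B₀ : Set ι) E)) (u * v) =
          u * gaussConv R (interCov R cl π (outCov R cl (↑B₀ : Set ι) E)) v := by
      intro u v hu hu0
      refine gaussConv_mul_eq_mul_of_mem R _ (fun X Y h => ?_) hu hu0 v
      simp only [Set.mem_preimage, Finset.mem_coe] at h
      simp only [interCov, outCov, Matrix.of_apply]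
      split_ifs with h1 h2
      · rfl
      · exfalso; rcases h with h | h
        · exact h2.1 h
        · exact h2.2 h
      · rfl
    have hprod : (∏ B ∈ π, (⟨gaussConv R (inCov R cl (↑B : Set ι) (outCov R cl (↑B₀ : Set ι) E)) (x B), (mem_evenPart_iff).2
          (gaussConv_mem_evenOdd R _ ((mem_evenPart_iff).1 (x B).2))⟩ : evenPart R Γ)) =
        ∏ B ∈ π, (⟨gaussConv R (inCov R cl (↑B : Set ι) E) (x B), (mem_evenPart_iff).2
          (gaussConv_mem_evenOdd R _ ((mem_evenPart_iff).1 (x B).2))⟩ : evenPart R Γ) :=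
      Finset.prod_congr rfl fun B hB => Subtype.ext (by
        simp only
        rw [inCov_outCov_of_disjoint R cl (hdisj0 B hB)])
    rw [hprod, hpass _ _ (gaussConv_mem_fieldSubalgebra R _ (hx B₀)) (gaussConv_mem_evenOdd R _ ((mem_evenPart_iff).1 (x B₀).2))]

end Blocks

end Summit.HubbardSuperconductivity.HubbardSuperconductivity.Theorems.KLRegimeWick

end
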